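import Summits.BirchSwinnertonDyer.BirchSwinnertonDyer.Theorems.TeichmullerTwistDescentPrincipalSeriesCells
import Summits.BirchSwinnertonDyer.BirchSwinnertonDyer.Theorems.AdditiveKolyvaginRoadManinFrameResidueProperTwistDegree
import Summits.BirchSwinnertonDyer.BirchSwinnertonDyer.Theorems.AdditiveKolyvaginRoadManinResidueDegreeOptimal
import HarnessLib

/-!
# Route `TeichmullerTwistDescent`, cruxes PSMU (stmt-BirchSwinnertonDyer-22638) / SCMU57
# (stmt-BirchSwinnertonDyer-22639): the on-curve cells ARE route AdditiveKolyvaginRoad's two registered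
# Manin stubs (S57, TDS) read at the optimal curve — the two lines carry the SAME open content (`--supports`)

Cell `pub/bsd-wall` (D-0145 line route-BirchSwinnertonDyer-TeichmullerTwistDescent, DRAFT rev 0), seat
`bsd-line-ttd-p2` (prover 2/2, g0). THEOREMS ONLY (no definition, no named fact, no `sorry`); nothing is
booked, no item is closed, BSD is not proved by this.

`TeichmullerTwistDescentPrincipalSeriesCells.lean` (p580436) reduced the line's Manin cruxes to three
on-curve cells at the `X₀(N)`-optimal curve: (PS≥11), (PS57), (SC57). This file identifies them with
the registered stubs of the line `birth` of AKR's crux `ManinFrameResidueProperR`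
(stmt-BirchSwinnertonDyer-20709; `Cruxes/ManinFrameResidueProperR/Lines/birth.lean`):

* §1 `not_dvd_optimal_of_member` — a member `W₀ ∼ W` with a level-`N` datum having `p ∤ c` forces
  `p ∤ c(D)` for the LATTICE-OPTIMAL datum `D` of `W` at level `N` (`E[p]` irreducible; the two-way
  prime-to-`p` transport `ManinFrameTransport.not_dvd_optimal_c_of_exists_not_dvd`).
* §2 `cell57_of_memberManinUnit57` — **(PS57) and (SC57) ⟸ S57** (`stub_memberManinUnit_fiveSeven`:
  on the `p ∈ {5,7}` proper residue some minimal member has a level-`N(W)` datum with `p ∤ c`),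
  granted Modularity `hnf` and Česnavičius–Neururer–Saha Thm. 1.2 `hCNS` (which closes the complement
  of the proper residue, the degree class, `ManinFrameTransport.exists_modularParametrizationData_not_dvd_of_not_dvd_modularDegree`).
  The Weil type ((G)-ordinary or not) is not used: S57 does not see it.
* §3 `cellPS11_of_twistDegreeStep` — **(PS≥11) ⟸ TDS** (`stub_twistDegreeStep`, Edixhoven's §4
  "case 2" as a statement about two modular degrees), granted `hnf`, Edixhoven Thm. 3 in both readings
  `hEdx`/`hEdxK` and Dokchitser–Dokchitser Thm. 5.1 (1) `hDD`
  (`ManinFrameResidueProperTwistDegree.stub_memberManinUnit_ordinary_of_twistDegreeStep`); and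
  `twistDegreeStep_of_cellPS11` — **TDS ⟸ (PS≥11)** granted `hnf`, `hDD` (the optimal member of the
  class, `ManinResidueDegreeOptimal.exists_optimal_dvd_iff`, is again unstarred (G)-ordinary by
  `not_typeGOrd_or_four_lt_of_isIsogenous`; then `twistDegreeStep_of_exists_member_not_dvd_c`).
* §5 `memberManinUnit57_of_cell57` (+ `cell57_of_cellsPS57_SC57`) — conversely **S57 ⟸ (PS57) ∧ (SC57)**
  granted `hnf` (the optimal member of the residue class is `Iₙ*`-free, additive, `E[p]`-irreducible), so
  S57 ⟺ (PS57) ∧ (SC57) granted `hnf`, `hCNS`.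
* §4 `principalSeriesOptimalManinUnit_of_residueStubs` / `supercuspidalOptimalManinUnitFiveSeven_of_residueStub`
  — **PSMU ⟸ TDS ∧ S57 and SCMU57 ⟸ S57, granted the printed facts** (`hEdx`, `hEdxK`, `hDD`, `hCNS`,
  `hnf` — all conjuncts of the route's `PublishedManinFacts` / `PublishedInputsAdditiveKoly`).

CONSEQUENCE FOR THE D-0145 DESK (numbers, not adjectives): granted print, the open content of route
TeichmullerTwistDescent's cruxes #2, #3 is contained in that of AKR's crux #7 stubs {TDS, S57}, and
conversely AKR's residue `ManinFrameResidueProperR` follows from PSMU ∧ SCMU57 (the route's own `closes`,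
step (1)); (PS≥11) ⟺ TDS exactly. The line TTD therefore adds NO proof obligation and removes none —
its content is the proposed MECHANISM (order-`e` Teichmüller twist to `Γ₁(p)`-level), which is not typed
(definition requests D1–D3 of the route). [cite: EdixhovenManin1991, Thm. 3 and §4]
[cite: CesnaviciusNeururerSaha2023, Thm. 1.2] [cite: DokchitserDokchitser2015LocalInvariants, Thm. 5.1 (1)]
[cite: AgasheRibetStein2006, Thm. 2.6 and §2]
-/

set_option autoImplicit false
-- single-conjunct summit: `Summit.BirchSwinnertonDyer.BirchSwinnertonDyer.…` repeats the name by design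
set_option linter.dupNamespace false

noncomputable section

open scoped Classical

open WeierstrassCurve IsDedekindDomain Rat.HeightOneSpectrum
  Literature.NumberTheory.EllipticCurves Literature.NumberTheory.EllipticCurves.ModularForms
  Literature.NumberTheory.EllipticCurves.Rank1Residual Literature.NumberTheory.DiophantineGeometry
  Summit.BirchSwinnertonDyer.Rank1Residual Summit.BirchSwinnertonDyer.Rank1Residual.Additive
  Summit.BirchSwinnertonDyer.BirchSwinnertonDyer.Theses.TeichmullerTwistDescent
  Summit.BirchSwinnertonDyer.BirchSwinnertonDyer.Theorems

namespace Summit.BirchSwinnertonDyer.BirchSwinnertonDyer.Theorems.TeichmullerTwistDescent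

/-! ### §1 From a member with `p ∤ c` to the optimal datum -/

/-- Bookkeeping: a property of all lattice-optimal data at level `M` holds at any level `N = M`
(levels of data are conductors; `subst`). [folklore] -/
theorem not_dvd_of_level_eq {W₀ : WeierstrassCurve ℚ} {N M : ℕ} [NeZero N] [NeZero M] (h : M = N)
    {p : ℕ} (hM : ∀ D : ModularParametrizationData W₀ M,
      (∀ z ∈ D.L.lattice, ∃ w ∈ periodLattice D.f, z = D.c * w) → ¬ (p : ℤ) ∣ D.c)
    (D : ModularParametrizationData W₀ N)
    (hlat : ∀ z ∈ D.L.lattice, ∃ w ∈ periodLattice D.f, z = D.c * w) : ¬ (p : ℤ) ∣ D.c := by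
  subst h
  exact hM D hlat

/-- **A member with a Manin-unit datum forces `p ∤ c` at the lattice-optimal datum** (`E[p]`
irreducible): if some globally minimal `W₀ ∼ W` has a datum `D₀` at level `N` with `p ∤ c(D₀)` and `D`
is a lattice-optimal datum of `W` at level `N` (`Λ_W = c·Λ_f`), then `p ∤ c(D)`. Two-way prime-to-`p`
transport (`ManinFrameTransport.not_dvd_optimal_c_of_exists_not_dvd`, read from the member).
[cite: AgasheRibetStein2006, Thm. 2.6 and §2] [cite: EdixhovenManin1991, Prop. 2] -/
theorem not_dvd_optimal_of_member (W : WeierstrassCurve ℚ) [W.IsElliptic] [W.IsGloballyMinimal]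
    {p : ℕ} [Fact p.Prime] (hirr : Irr W p) {N : ℕ} [NeZero N] (D : ModularParametrizationData W N)
    (hlat : ∀ z ∈ D.L.lattice, ∃ w ∈ periodLattice D.f, z = D.c * w)
    (h : ∃ (W₀ : WeierstrassCurve ℚ) (_ : W₀.IsElliptic) (_ : W₀.IsGloballyMinimal)
      (D₀ : ModularParametrizationData W₀ N), IsIsogenous W W₀ ∧ ¬ (p : ℤ) ∣ D₀.c) :
    ¬ (p : ℤ) ∣ D.c := by
  obtain ⟨W₀, hE₀, hM₀, D₀, hiso, hc₀⟩ := h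
  haveI := hE₀
  haveI := hM₀
  have hirr₀ : Irr W₀ p := (X12.irr_iff_of_isIsogenous hiso p).mp hirr
  exact ManinFrameTransport.not_dvd_optimal_c_of_exists_not_dvd W₀ (Fact.out : p.Prime) hirr₀
    ⟨D₀, hc₀⟩ hiso.symm_of_charZero D hlat

/-! ### §2 The cells at `p ∈ {5, 7}` from AKR's stub S57 -/

/-- **(PS57) and (SC57) — indeed the Weil-type-free cell at `p ∈ {5, 7}` — from S57.** Granted
Modularity (`hnf`) and Česnavičius–Neururer–Saha Thm. 1.2 (`hCNS`): if on the proper residue at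
`p ∈ {5, 7}` (additive, `E[p]` irreducible, an `Iₙ*`-free member, every level-`N(W)` datum of every
minimal member of degree divisible by `p`) some minimal member carries a level-`N(W)` datum with `p ∤ c`
(AKR's registered stub `stub_memberManinUnit_fiveSeven`, binders verbatim after `hnf`), then for every
globally minimal `W` with a lattice-optimal datum `D` at its conductor level, additive at `p ∈ {5, 7}`
with `E[p]` irreducible and no `Iₙ*` fibre at `(p)`: `p ∤ c(D)`. Off the proper residue the degree class
is closed by ČNS; on it, S57; both land on `D` by §1. [cite: CesnaviciusNeururerSaha2023, Thm. 1.2] -/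
theorem cell57_of_memberManinUnit57 (hnf : exists_isNewformOf)
    (hCNS : cesnaviciusNeururerSaha_padicVal_maninConstant_le_modularDegree)
    (h57 : ∀ (W : WeierstrassCurve ℚ) [W.IsElliptic] [W.IsGloballyMinimal] (p : ℕ) [Fact p.Prime]
      [NeZero (W.conductorNorm ℤ)], 5 ≤ p → p < 11 → Addv W p → Irr W p →
      ((p < 11 ∨ ∃ (W' : WeierstrassCurve ℚ) (_ : W'.IsElliptic) (_ : W'.IsGloballyMinimal),
          IsIsogenous W W' ∧ TypeGOrd W' p ∧ padicValInt p W'.minimalDiscriminantInt ≤ 4) ∧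
        (∃ (W' : WeierstrassCurve ℚ) (_ : W'.IsElliptic) (_ : W'.IsGloballyMinimal),
          IsIsogenous W W' ∧ ∀ (v : HeightOneSpectrum ℤ) (n : ℕ), natGenerator v = p →
            W'.kodairaSymbolAt v ≠ KodairaSymbol.Istar n)) →
      (∀ (W' : WeierstrassCurve ℚ) [W'.IsElliptic] [W'.IsGloballyMinimal]
          (D' : ModularParametrizationData W' (W.conductorNorm ℤ)),
          IsIsogenous W W' → p ∣ D'.modularDegree) →
      ∃ (W₀ : WeierstrassCurve ℚ) (_ : W₀.IsElliptic) (_ : W₀.IsGloballyMinimal)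
        (D₀ : ModularParametrizationData W₀ (W.conductorNorm ℤ)),
        IsIsogenous W W₀ ∧ ¬ (p : ℤ) ∣ D₀.c) :
    ∀ (W : WeierstrassCurve ℚ) [W.IsElliptic] [W.IsGloballyMinimal] (p : ℕ) [Fact p.Prime]
      [NeZero (W.conductorNorm ℤ)] (D : ModularParametrizationData W (W.conductorNorm ℤ)),
      (p = 5 ∨ p = 7) → Addv W p → Irr W p →
      (∀ n : ℕ, W.kodairaSymbolAt (placeOf p) ≠ .Istar n) →
      (∀ z ∈ D.L.lattice, ∃ w ∈ periodLattice D.f, z = D.c * w) → ¬ (p : ℤ) ∣ D.c := by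
  intro W _ _ p _ _ D hp57 hadd hirr hI hlat
  have hp : p.Prime := Fact.out
  have hp5 : 5 ≤ p := by rcases hp57 with rfl | rfl <;> omega
  have hp11 : p < 11 := by rcases hp57 with rfl | rfl <;> omega
  by_cases hall : ∀ (W' : WeierstrassCurve ℚ) [W'.IsElliptic] [W'.IsGloballyMinimal]
      (D' : ModularParametrizationData W' (W.conductorNorm ℤ)), IsIsogenous W W' → p ∣ D'.modularDegree
  · -- proper residue: S57
    exact not_dvd_optimal_of_member W hirr D hlat
      (h57 W p hp5 hp11 hadd hirr
        ⟨Or.inl hp11, W, ‹_›, ‹_›, isIsogenous_self W, (forall_ne_Istar_iff_placeOf W p).mpr hI⟩ hall)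
  · -- degree class: ČNS
    push Not at hall
    obtain ⟨W', hE', hM', D', hiso, hdeg⟩ := hall
    haveI := hE'
    haveI := hM'
    obtain ⟨Dt, hc⟩ :=
      ManinFrameTransport.exists_modularParametrizationData_not_dvd_of_not_dvd_modularDegree hnf hCNS W
        hp hp5 hirr hiso D' hdeg
    exact not_dvd_optimal_of_member W hirr D hlat ⟨W, ‹_›, ‹_›, Dt, isIsogenous_self W, hc⟩

/-! ### §3 The cell at `p ≥ 11` IS the twist-degree step -/

/-- **(PS≥11) ⟸ TDS** (the class-level twist-degree step of AKR's registered stub `stub_twistDegreeStep`,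
here as a closed statement over all frames `(W, p)`, `p ≥ 11`, additive, `E[p]` irreducible), granted
Modularity, Edixhoven 1991 Thm. 3 (both readings) and Dokchitser–Dokchitser 2015 Thm. 5.1 (1): the frame
is `W` itself (unstarred, (G)-ordinary, `Iₙ*`-free since `ord_p Δ_min ≤ 4`), AKR's
`stub_memberManinUnit_ordinary_of_twistDegreeStep` gives a member with `p ∤ c`, §1 lands it on `D`.
[cite: EdixhovenManin1991, Thm. 3 and §4] [cite: DokchitserDokchitser2015LocalInvariants, Thm. 5.1 (1)] -/
theorem cellPS11_of_twistDegreeStep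
    (hEdx : edixhoven_not_dvd_maninConstant_of_not_potentiallyGoodOrdinary)
    (hEdxK : edixhoven_not_dvd_maninConstant_of_kodairaSymbol_ne)
    (hDD : dokchitser_padicValInt_minimalDiscriminantInt_eq_of_isogeny_of_not_dvd_degree)
    (hnf : exists_isNewformOf)
    (hTDS : ∀ (W : WeierstrassCurve ℚ) [W.IsElliptic] [W.IsGloballyMinimal] (p : ℕ) [Fact p.Prime]
      [NeZero (W.conductorNorm ℤ)], 11 ≤ p → Addv W p → Irr W p →
      ∀ (V : WeierstrassCurve ℚ) [V.IsElliptic] [V.IsGloballyMinimal] [NeZero (V.conductorNorm ℤ)]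
        (Wf : WeierstrassCurve ℚ) [Wf.IsElliptic] [Wf.IsGloballyMinimal] [NeZero (Wf.conductorNorm ℤ)]
        (C : VariableChange ℚ), IsIsogenous W V → TypeGOrd V p →
        padicValInt p V.minimalDiscriminantInt ≤ 4 →
        C • V.quadraticTwist ((-1 : ℚ) ^ (p / 2) * p) = Wf →
        ∃ D : ModularParametrizationData V (V.conductorNorm ℤ),
          ∀ Df : ModularParametrizationData Wf (Wf.conductorNorm ℤ),
            padicValNat p D.modularDegree < padicValNat p Df.modularDegree) :
    ∀ (W : WeierstrassCurve ℚ) [W.IsElliptic] [W.IsGloballyMinimal] (p : ℕ) [Fact p.Prime]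
      [NeZero (W.conductorNorm ℤ)] (D : ModularParametrizationData W (W.conductorNorm ℤ)),
      11 ≤ p → Addv W p → Irr W p → TypeGOrd W p → padicValInt p W.minimalDiscriminantInt ≤ 4 →
      (∀ z ∈ D.L.lattice, ∃ w ∈ periodLattice D.f, z = D.c * w) → ¬ (p : ℤ) ∣ D.c := by
  intro W _ _ p _ _ D h11 hadd hirr hG hv4 hlat
  have hI : ∀ (v : HeightOneSpectrum ℤ) (n : ℕ), natGenerator v = p →
      W.kodairaSymbolAt v ≠ KodairaSymbol.Istar n :=
    (forall_ne_Istar_iff_placeOf W p).mpr (forall_ne_Istar_of_padicValInt_le_four W p (by omega) hadd hv4)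
  exact not_dvd_optimal_of_member W hirr D hlat
    (ManinFrameResidueProperTwistDegree.stub_memberManinUnit_ordinary_of_twistDegreeStep hEdx hEdxK hDD
      hnf W p h11 hadd hirr
      ⟨Or.inr ⟨W, ‹_›, ‹_›, isIsogenous_self W, hG, hv4⟩, W, ‹_›, ‹_›, isIsogenous_self W, hI⟩
      (hTDS W p h11 hadd hirr))

/-- **TDS ⟸ (PS≥11)**, granted Modularity and Dokchitser–Dokchitser 2015 Thm. 5.1 (1): for a frame
`(W, p)` with an unstarred (G)-ordinary member `V` and a minimal model `W♭` of `V ⊗ χ_{p*}`, the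
`X₀(N)`-optimal member `W₀` of the class (`ManinResidueDegreeOptimal.exists_optimal_dvd_iff`) is again
(G)-ordinary with `ord_p Δ_min ≤ 4` (`not_typeGOrd_or_four_lt_of_isIsogenous`, from `V`), so (PS≥11)
gives `p ∤ c₀`, and `twistDegreeStep_of_exists_member_not_dvd_c` turns that member into the degree
inequality. Hence **(PS≥11) ⟺ TDS granted print.** [cite: EdixhovenManin1991, §4]
[cite: DokchitserDokchitser2015LocalInvariants, Thm. 5.1 (1)] -/
theorem twistDegreeStep_of_cellPS11
    (hDD : dokchitser_padicValInt_minimalDiscriminantInt_eq_of_isogeny_of_not_dvd_degree)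
    (hnf : exists_isNewformOf)
    (h11 : ∀ (W : WeierstrassCurve ℚ) [W.IsElliptic] [W.IsGloballyMinimal] (p : ℕ) [Fact p.Prime]
      [NeZero (W.conductorNorm ℤ)] (D : ModularParametrizationData W (W.conductorNorm ℤ)),
      11 ≤ p → Addv W p → Irr W p → TypeGOrd W p → padicValInt p W.minimalDiscriminantInt ≤ 4 →
      (∀ z ∈ D.L.lattice, ∃ w ∈ periodLattice D.f, z = D.c * w) → ¬ (p : ℤ) ∣ D.c) :
    ∀ (W : WeierstrassCurve ℚ) [W.IsElliptic] [W.IsGloballyMinimal] (p : ℕ) [Fact p.Prime]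
      [NeZero (W.conductorNorm ℤ)], 11 ≤ p → Addv W p → Irr W p →
      ∀ (V : WeierstrassCurve ℚ) [V.IsElliptic] [V.IsGloballyMinimal] [NeZero (V.conductorNorm ℤ)]
        (Wf : WeierstrassCurve ℚ) [Wf.IsElliptic] [Wf.IsGloballyMinimal] [NeZero (Wf.conductorNorm ℤ)]
        (C : VariableChange ℚ), IsIsogenous W V → TypeGOrd V p →
        padicValInt p V.minimalDiscriminantInt ≤ 4 →
        C • V.quadraticTwist ((-1 : ℚ) ^ (p / 2) * p) = Wf →
        ∃ D : ModularParametrizationData V (V.conductorNorm ℤ),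
          ∀ Df : ModularParametrizationData Wf (Wf.conductorNorm ℤ),
            padicValNat p D.modularDegree < padicValNat p Df.modularDegree := by
  intro W _ _ p _ _ hp11 hadd hirr V _ _ _ Wf _ _ _ C hisoV hG hV4 hC
  have hp5 : 5 ≤ p := by omega
  have hp2 : p ≠ 2 := by omega
  -- the optimal member `W₀` of the class with its lattice-optimal datum at level `N(W)`
  obtain ⟨W₀, hE₀, hM₀, D₀, hiso₀, hlat₀, -⟩ := ManinResidueDegreeOptimal.exists_optimal_dvd_iff hnf p W
  haveI := hE₀
  haveI := hM₀
  haveI : NeZero (W₀.conductorNorm ℤ) := ⟨(W₀.conductorNorm_pos_holds).ne'⟩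
  have hadd₀ : Addv W₀ p := (X2.addv_iff_of_isIsogenous (p := p) hiso₀).mp hadd
  have hirr₀ : Irr W₀ p := (X12.irr_iff_of_isIsogenous hiso₀ p).mp hirr
  have hiso₀V : IsIsogenous W₀ V := hiso₀.symm_of_charZero.trans' hisoV
  have haddV : Addv V p := (X2.addv_iff_of_isIsogenous (p := p) hisoV).mp hadd
  have hG₀ : TypeGOrd W₀ p := (typeGOrd_iff_of_isIsogenous hp2 hadd₀ hiso₀V).mpr hG
  have hv₀ : padicValInt p W₀.minimalDiscriminantInt ≤ 4 := by
    by_contra hv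
    rcases ManinFrameResidueProperTwistDegree.not_typeGOrd_or_four_lt_of_isIsogenous hDD hp5 hadd₀ hirr₀
        hiso₀V (by omega) with h | h
    · exact h hG
    · omega
  -- the datum `D₀` lives at level `N(W) = N(W₀)`
  have hN : W.conductorNorm ℤ = W₀.conductorNorm ℤ :=
    IsNewformOf.level_eq_conductorNorm_of_exists_isNewformOf hnf D₀.isNewformOf
  have hc₀ : ¬ (p : ℤ) ∣ D₀.c :=
    not_dvd_of_level_eq hN.symm (fun D hD => h11 W₀ p D hp11 hadd₀ hirr₀ hG₀ hv₀ hD) D₀ hlat₀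
  exact ManinFrameResidueProperTwistDegree.twistDegreeStep_of_exists_member_not_dvd_c hnf W hp5 hadd
    hirr hisoV hG hV4 C hC ⟨W₀, hE₀, hM₀, D₀, hiso₀, hc₀⟩

/-! ### §4 The route's cruxes from AKR's stubs, granted print -/

/-- **PSMU ⟸ TDS ∧ S57, granted the printed facts** (Edixhoven Thm. 3 both readings, Dokchitser–Dokchitser
Thm. 5.1 (1), Česnavičius–Neururer–Saha Thm. 1.2, Modularity): composition of
`principalSeriesOptimalManinUnit_of_cells` (p580436) with §2 and §3.
[cite: EdixhovenManin1991, Thm. 3 and §4] [cite: CesnaviciusNeururerSaha2023, Thm. 1.2] -/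
theorem principalSeriesOptimalManinUnit_of_residueStubs
    (hEdx : edixhoven_not_dvd_maninConstant_of_not_potentiallyGoodOrdinary)
    (hEdxK : edixhoven_not_dvd_maninConstant_of_kodairaSymbol_ne)
    (hDD : dokchitser_padicValInt_minimalDiscriminantInt_eq_of_isogeny_of_not_dvd_degree)
    (hCNS : cesnaviciusNeururerSaha_padicVal_maninConstant_le_modularDegree)
    (hnf : exists_isNewformOf)
    (hTDS : ∀ (W : WeierstrassCurve ℚ) [W.IsElliptic] [W.IsGloballyMinimal] (p : ℕ) [Fact p.Prime]
      [NeZero (W.conductorNorm ℤ)], 11 ≤ p → Addv W p → Irr W p →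
      ∀ (V : WeierstrassCurve ℚ) [V.IsElliptic] [V.IsGloballyMinimal] [NeZero (V.conductorNorm ℤ)]
        (Wf : WeierstrassCurve ℚ) [Wf.IsElliptic] [Wf.IsGloballyMinimal] [NeZero (Wf.conductorNorm ℤ)]
        (C : VariableChange ℚ), IsIsogenous W V → TypeGOrd V p →
        padicValInt p V.minimalDiscriminantInt ≤ 4 →
        C • V.quadraticTwist ((-1 : ℚ) ^ (p / 2) * p) = Wf →
        ∃ D : ModularParametrizationData V (V.conductorNorm ℤ),
          ∀ Df : ModularParametrizationData Wf (Wf.conductorNorm ℤ),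
            padicValNat p D.modularDegree < padicValNat p Df.modularDegree)
    (h57 : ∀ (W : WeierstrassCurve ℚ) [W.IsElliptic] [W.IsGloballyMinimal] (p : ℕ) [Fact p.Prime]
      [NeZero (W.conductorNorm ℤ)], 5 ≤ p → p < 11 → Addv W p → Irr W p →
      ((p < 11 ∨ ∃ (W' : WeierstrassCurve ℚ) (_ : W'.IsElliptic) (_ : W'.IsGloballyMinimal),
          IsIsogenous W W' ∧ TypeGOrd W' p ∧ padicValInt p W'.minimalDiscriminantInt ≤ 4) ∧
        (∃ (W' : WeierstrassCurve ℚ) (_ : W'.IsElliptic) (_ : W'.IsGloballyMinimal),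
          IsIsogenous W W' ∧ ∀ (v : HeightOneSpectrum ℤ) (n : ℕ), natGenerator v = p →
            W'.kodairaSymbolAt v ≠ KodairaSymbol.Istar n)) →
      (∀ (W' : WeierstrassCurve ℚ) [W'.IsElliptic] [W'.IsGloballyMinimal]
          (D' : ModularParametrizationData W' (W.conductorNorm ℤ)),
          IsIsogenous W W' → p ∣ D'.modularDegree) →
      ∃ (W₀ : WeierstrassCurve ℚ) (_ : W₀.IsElliptic) (_ : W₀.IsGloballyMinimal)
        (D₀ : ModularParametrizationData W₀ (W.conductorNorm ℤ)),
        IsIsogenous W W₀ ∧ ¬ (p : ℤ) ∣ D₀.c) :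
    PrincipalSeriesOptimalManinUnit :=
  principalSeriesOptimalManinUnit_of_cells hEdxK hnf (cellPS11_of_twistDegreeStep hEdx hEdxK hDD hnf hTDS)
    (fun W _ _ p _ _ D hp57 hadd hirr _ hI hlat =>
      cell57_of_memberManinUnit57 hnf hCNS h57 W p D hp57 hadd hirr hI hlat)

/-- **SCMU57 ⟸ S57, granted Česnavičius–Neururer–Saha Thm. 1.2 and Modularity**: composition of
`supercuspidalOptimalManinUnitFiveSeven_of_cell` (p580436) with §2. [cite: CesnaviciusNeururerSaha2023, Thm. 1.2] -/
theorem supercuspidalOptimalManinUnitFiveSeven_of_residueStub (hnf : exists_isNewformOf)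
    (hCNS : cesnaviciusNeururerSaha_padicVal_maninConstant_le_modularDegree)
    (h57 : ∀ (W : WeierstrassCurve ℚ) [W.IsElliptic] [W.IsGloballyMinimal] (p : ℕ) [Fact p.Prime]
      [NeZero (W.conductorNorm ℤ)], 5 ≤ p → p < 11 → Addv W p → Irr W p →
      ((p < 11 ∨ ∃ (W' : WeierstrassCurve ℚ) (_ : W'.IsElliptic) (_ : W'.IsGloballyMinimal),
          IsIsogenous W W' ∧ TypeGOrd W' p ∧ padicValInt p W'.minimalDiscriminantInt ≤ 4) ∧
        (∃ (W' : WeierstrassCurve ℚ) (_ : W'.IsElliptic) (_ : W'.IsGloballyMinimal),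
          IsIsogenous W W' ∧ ∀ (v : HeightOneSpectrum ℤ) (n : ℕ), natGenerator v = p →
            W'.kodairaSymbolAt v ≠ KodairaSymbol.Istar n)) →
      (∀ (W' : WeierstrassCurve ℚ) [W'.IsElliptic] [W'.IsGloballyMinimal]
          (D' : ModularParametrizationData W' (W.conductorNorm ℤ)),
          IsIsogenous W W' → p ∣ D'.modularDegree) →
      ∃ (W₀ : WeierstrassCurve ℚ) (_ : W₀.IsElliptic) (_ : W₀.IsGloballyMinimal)
        (D₀ : ModularParametrizationData W₀ (W.conductorNorm ℤ)),
        IsIsogenous W W₀ ∧ ¬ (p : ℤ) ∣ D₀.c) :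
    SupercuspidalOptimalManinUnitFiveSeven :=
  supercuspidalOptimalManinUnitFiveSeven_of_cell hnf
    (fun W _ _ p _ _ D hp57 hadd hirr _ hI hlat =>
      cell57_of_memberManinUnit57 hnf hCNS h57 W p D hp57 hadd hirr hI hlat)

/-! ### §5 Conversely: AKR's stub S57 from the cell at `p ∈ {5, 7}` (so S57 ⟺ (PS57) ∧ (SC57) granted print) -/

/-- **The Weil-type-free cell at `p ∈ {5, 7}` from (PS57) and (SC57)** (case on `TypeGOrd W p`). [folklore] -/
theorem cell57_of_cellsPS57_SC57
    (hPS : ∀ (W : WeierstrassCurve ℚ) [W.IsElliptic] [W.IsGloballyMinimal] (p : ℕ) [Fact p.Prime]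
      [NeZero (W.conductorNorm ℤ)] (D : ModularParametrizationData W (W.conductorNorm ℤ)),
      (p = 5 ∨ p = 7) → Addv W p → Irr W p → TypeGOrd W p →
      (∀ n : ℕ, W.kodairaSymbolAt (placeOf p) ≠ .Istar n) →
      (∀ z ∈ D.L.lattice, ∃ w ∈ periodLattice D.f, z = D.c * w) → ¬ (p : ℤ) ∣ D.c)
    (hSC : ∀ (W : WeierstrassCurve ℚ) [W.IsElliptic] [W.IsGloballyMinimal] (p : ℕ) [Fact p.Prime]
      [NeZero (W.conductorNorm ℤ)] (D : ModularParametrizationData W (W.conductorNorm ℤ)),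
      (p = 5 ∨ p = 7) → Addv W p → Irr W p → ¬ TypeGOrd W p →
      (∀ n : ℕ, W.kodairaSymbolAt (placeOf p) ≠ .Istar n) →
      (∀ z ∈ D.L.lattice, ∃ w ∈ periodLattice D.f, z = D.c * w) → ¬ (p : ℤ) ∣ D.c) :
    ∀ (W : WeierstrassCurve ℚ) [W.IsElliptic] [W.IsGloballyMinimal] (p : ℕ) [Fact p.Prime]
      [NeZero (W.conductorNorm ℤ)] (D : ModularParametrizationData W (W.conductorNorm ℤ)),
      (p = 5 ∨ p = 7) → Addv W p → Irr W p →
      (∀ n : ℕ, W.kodairaSymbolAt (placeOf p) ≠ .Istar n) →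
      (∀ z ∈ D.L.lattice, ∃ w ∈ periodLattice D.f, z = D.c * w) → ¬ (p : ℤ) ∣ D.c := by
  intro W _ _ p _ _ D hp57 hadd hirr hI hlat
  by_cases hG : TypeGOrd W p
  · exact hPS W p D hp57 hadd hirr hG hI hlat
  · exact hSC W p D hp57 hadd hirr hG hI hlat

/-- **S57 ⟸ the cell at `p ∈ {5, 7}`, granted Modularity** (so, with §2, AKR's registered stub
`stub_memberManinUnit_fiveSeven` is EQUIVALENT to (PS57) ∧ (SC57) granted `hnf` and ČNS): on a frame of
the `p ∈ {5, 7}` residue the `X₀(N)`-optimal member `W₀` with its lattice-optimal datum at level `N(W)`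
(`ManinResidueDegreeOptimal.exists_optimal_dvd_iff`) is additive with `E[p]` irreducible (isogeny
invariants) and `Iₙ*`-free (transport from the `Iₙ*`-free member, §0 of p580436), so the cell gives
`p ∤ c₀`; the universal degree clause of S57 is not used. This is the p ∈ {5,7} half of the route's
glue G-WT, read stub-to-cell. [cite: BCDTJAMS2001, Thm. A] [cite: Knapp1993, Prop. 12.9(a)] -/
theorem memberManinUnit57_of_cell57 (hnf : exists_isNewformOf)
    (hcell : ∀ (W : WeierstrassCurve ℚ) [W.IsElliptic] [W.IsGloballyMinimal] (p : ℕ) [Fact p.Prime]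
      [NeZero (W.conductorNorm ℤ)] (D : ModularParametrizationData W (W.conductorNorm ℤ)),
      (p = 5 ∨ p = 7) → Addv W p → Irr W p →
      (∀ n : ℕ, W.kodairaSymbolAt (placeOf p) ≠ .Istar n) →
      (∀ z ∈ D.L.lattice, ∃ w ∈ periodLattice D.f, z = D.c * w) → ¬ (p : ℤ) ∣ D.c) :
    ∀ (W : WeierstrassCurve ℚ) [W.IsElliptic] [W.IsGloballyMinimal] (p : ℕ) [Fact p.Prime]
      [NeZero (W.conductorNorm ℤ)], 5 ≤ p → p < 11 → Addv W p → Irr W p →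
      ((p < 11 ∨ ∃ (W' : WeierstrassCurve ℚ) (_ : W'.IsElliptic) (_ : W'.IsGloballyMinimal),
          IsIsogenous W W' ∧ TypeGOrd W' p ∧ padicValInt p W'.minimalDiscriminantInt ≤ 4) ∧
        (∃ (W' : WeierstrassCurve ℚ) (_ : W'.IsElliptic) (_ : W'.IsGloballyMinimal),
          IsIsogenous W W' ∧ ∀ (v : HeightOneSpectrum ℤ) (n : ℕ), natGenerator v = p →
            W'.kodairaSymbolAt v ≠ KodairaSymbol.Istar n)) →
      (∀ (W' : WeierstrassCurve ℚ) [W'.IsElliptic] [W'.IsGloballyMinimal]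
          (D' : ModularParametrizationData W' (W.conductorNorm ℤ)),
          IsIsogenous W W' → p ∣ D'.modularDegree) →
      ∃ (W₀ : WeierstrassCurve ℚ) (_ : W₀.IsElliptic) (_ : W₀.IsGloballyMinimal)
        (D₀ : ModularParametrizationData W₀ (W.conductorNorm ℤ)),
        IsIsogenous W W₀ ∧ ¬ (p : ℤ) ∣ D₀.c := by
  intro W _ _ p _ _ hp5 hp11 hadd hirr hres _
  have hp : p.Prime := Fact.out
  have hp2 : p ≠ 2 := by omega
  have hp57 : p = 5 ∨ p = 7 :=
    WeilTypeManinGlue.eq_five_or_eq_seven_of_prime_of_five_le_of_lt_eleven hp hp5 hp11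
  obtain ⟨-, W', hE', hM', hiso', hI'⟩ := hres
  haveI := hE'
  haveI := hM'
  -- the optimal member with its lattice-optimal datum at level `N(W)`
  obtain ⟨W₀, hE₀, hM₀, D₀, hiso₀, hlat₀, -⟩ := ManinResidueDegreeOptimal.exists_optimal_dvd_iff hnf p W
  haveI := hE₀
  haveI := hM₀
  haveI : NeZero (W₀.conductorNorm ℤ) := ⟨(W₀.conductorNorm_pos_holds).ne'⟩
  have hadd₀ : Addv W₀ p := (X2.addv_iff_of_isIsogenous (p := p) hiso₀).mp hadd
  have hirr₀ : Irr W₀ p := (X12.irr_iff_of_isIsogenous hiso₀ p).mp hirr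
  have hI₀ : ∀ n : ℕ, W₀.kodairaSymbolAt (placeOf p) ≠ .Istar n :=
    forall_ne_Istar_of_member W₀ p hp2 ⟨W', hE', hM', hiso₀.symm_of_charZero.trans' hiso', hI'⟩
  have hN : W.conductorNorm ℤ = W₀.conductorNorm ℤ :=
    IsNewformOf.level_eq_conductorNorm_of_exists_isNewformOf hnf D₀.isNewformOf
  exact ⟨W₀, hE₀, hM₀, D₀, hiso₀,
    not_dvd_of_level_eq hN.symm (fun D hD => hcell W₀ p D hp57 hadd₀ hirr₀ hI₀ hD) D₀ hlat₀⟩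

end Summit.BirchSwinnertonDyer.BirchSwinnertonDyer.Theorems.TeichmullerTwistDescent

end
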